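import Summits.CriticalPhenomena.PercolationContinuityZ3.Theorems.PercAnnulusCrossingIICTwoWindowsPieces
import Summits.CriticalPhenomena.PercolationContinuityZ3.Theorems.PercAnnulusCrossingIICWindowDensity
import HarnessLib

/-!
# Two far windows in two shells: the finite-volume decoupling `|P(E ∩ A_N) − P(E)π(N)| ≤ C(η₁ + η₂)P(E)π(N)` (lane RSW3, p1 gen 24)

builds on p205010 (kernel theorem, internal audit signed; external expert review pending) — NOT used in this file (only `p_c(ℤ^d) > 0`;
one-arm quasi-multiplicativity and the ratio bound are HYPOTHESES here, discharged from (A2)□ in `…IICTwoWindowsDensity`).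

RSW3 lane (LANE 3 `prim-rsw3`), seat `prim-rsw3-p1` (gen 24).  Helper file (`--supports stmt-CriticalPhenomena-4575`); no definitions,
no sorries.  Memo `run/shared/lean/prim/rsw3/P1-QM.md` §37.

* `abs_real_inter_siteToBoundary_sub_mul_le_twoShells_criticalProbI` — windows `Λ_{x_i}(m_i)`, `1 ≤ m_i`, `2m_i ≤ n_i = ‖x_i‖`, `8n₁ < n₂`,
  `E` determined by pairs each inside one window, `N ≥ 2n₂ + 2`:
  **`|P(E ∩ A_N) − P(E)·π(N)| ≤ (2B²/c² + B²/c² + B⁴/c³)·(η₁ + η₂)·P(E)·π(N)`**, `η_i = π(n_i)/π(m_i)` — the three alternatives of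
  `…IICTwoWindowsPieces` cost `2B²η₁π(N)/c²` (inner window last: head `≤ 2Bπ(n₁)`, exit `π(n₁)/(cπ(m₁))`, tail `Bπ(N)/(cπ(n₁))`),
  `B²η₂π(N)/c²` (outer first and last) and `B⁴η₂π(N)/c³` (inner first, outer last: head `Bπ(n₁)`, crossing of the empty annulus
  `Λ(n₂−m₂−1) ∖ Λ(n₁+m₁)` `≤ B²π(n₂)/(cπ(n₁))`, exit `π(n₂)/(cπ(m₂))`, tail `Bπ(N)/(cπ(n₂))`), via BK and the abstract decoupling
  `…IICSdiffDecoupling`.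
References: H. Kesten, PTRF 73 (1986) Thm. (3), (8); D. Basu, A. Sapozhnikov, ECP 22 (2017) §1 (A2); G. Grimmett, *Percolation* (1999) §2.3.
-/

noncomputable section

namespace Summit.CriticalPhenomena.PercolationContinuityZ3.Theorems.Crossing

open MeasureTheory Filter Topology Literature.Probability.Percolation Literature.Probability.LatticeModels
open Literature.Probability.Percolation.DCT16
open Summit.CriticalPhenomena.PercolationContinuityZ3.Theorems.SurfaceTension
open scoped Literature.Probability.Percolation

variable {d : ℕ}

/-! ## §1 Two windows in two shells: the finite-volume bound -/

open Classical in
/-- **TWO SHELLS, FINITE VOLUME** (`p_c(ℤ^d)`, `d ≥ 2`; one-arm quasi-multiplicativity with constant `c` and the ratio bound with constant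
`B`): for windows `Λ_{x_i}(m_i)`, `1 ≤ m_i`, `2m_i ≤ n_i = ‖x_i‖`, `8n₁ < n₂`, every event `E` determined by a finite set of pairs each inside
one of the windows, and every `N ≥ 2n₂ + 2`:
`|P(E ∩ A_N) − P(E)·π(N)| ≤ (2B²/c² + B²/c² + B⁴/c³)·(π(n₁)/π(m₁) + π(n₂)/π(m₂))·P(E)·π(N)`. [cite: Kesten1986, Thm. (3), (8)]
[cite: BasuSapozhnikov2017ECP, §1 (A2)] -/
theorem abs_real_inter_siteToBoundary_sub_mul_le_twoShells_criticalProbI (hd : 2 ≤ d) {cq B : ℝ} (hcq : 0 < cq)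
    (hQM : OneArmQuasiMultAt d (criticalProbI d) cq) (hB : 0 < B)
    (hR : ∀ j n : ℕ, 1 ≤ j → j ≤ n → n ≤ 8 * j → oneArmProb d (criticalProbI d) j ≤ B * oneArmProb d (criticalProbI d) n)
    {m₁ m₂ N : ℕ} {x₁ x₂ : Site d} (F : Finset (Sym2 (Site d))) {E : Set (BondConfig (Site d))}
    (hm₁ : 1 ≤ m₁) (h2m₁ : 2 * m₁ ≤ Site.supNorm x₁) (hm₂ : 1 ≤ m₂) (h2m₂ : 2 * m₂ ≤ Site.supNorm x₂)
    (hsep : 8 * Site.supNorm x₁ < Site.supNorm x₂)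
    (hF : ∀ e ∈ F, (∀ u ∈ e, u ∈ (box d m₁).image (· + x₁)) ∨ (∀ u ∈ e, u ∈ (box d m₂).image (· + x₂)))
    (hE : DeterminedBy E (↑F : Set (Sym2 (Site d)))) (hN : 2 * Site.supNorm x₂ + 2 ≤ N) :
    |(bondPercolation (zdGraph d) (criticalProbI d)).real (E ∩ siteToBoundary d N) -
        (bondPercolation (zdGraph d) (criticalProbI d)).real E * oneArmProb d (criticalProbI d) N| ≤
      (2 * B ^ 2 / cq ^ 2 + B ^ 2 / cq ^ 2 + B ^ 4 / cq ^ 3) *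
        (oneArmProb d (criticalProbI d) (Site.supNorm x₁) / oneArmProb d (criticalProbI d) m₁ +
          oneArmProb d (criticalProbI d) (Site.supNorm x₂) / oneArmProb d (criticalProbI d) m₂) *
        (bondPercolation (zdGraph d) (criticalProbI d)).real E * oneArmProb d (criticalProbI d) N := by
  have hd1 : 1 ≤ d := le_trans (by norm_num) hd
  have hp : 0 < ((criticalProbI d : unitInterval) : ℝ) := by
    rw [coe_criticalProbI]; exact criticalProb_zd_pos d hd1
  have hπ : ∀ m : ℕ, 0 < oneArmProb d (criticalProbI d) m := fun m => oneArmProb_pos hd1 _ hp m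
  set μ := bondPercolation (zdGraph d) (criticalProbI d) with hμ
  set n₁ := Site.supNorm x₁ with hn₁
  set n₂ := Site.supNorm x₂ with hn₂
  set ρ : ℕ := n₁ + m₁ with hρ
  set ρ' : ℕ := n₂ - m₂ - 1 with hρ'
  set η₁ := oneArmProb d (criticalProbI d) n₁ / oneArmProb d (criticalProbI d) m₁ with hη₁
  set η₂ := oneArmProb d (criticalProbI d) n₂ / oneArmProb d (criticalProbI d) m₂ with hη₂
  have hη₁0 : 0 ≤ η₁ := div_nonneg (hπ _).le (hπ _).le
  have hη₂0 : 0 ≤ η₂ := div_nonneg (hπ _).le (hπ _).le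
  -- windows and their geometry
  have hWnorm : ∀ (mm : ℕ) (xx : Site d), ∀ u ∈ (box d mm).image (· + xx),
      Site.supNorm xx ≤ Site.supNorm u + mm ∧ Site.supNorm u ≤ Site.supNorm xx + mm := by
    intro mm xx u hu
    obtain ⟨c, hc, rfl⟩ := Finset.mem_image.1 hu
    have hcm := mem_box_iff_supNorm_le.1 hc
    have h1 : Site.supNorm xx ≤ Site.supNorm (c + xx) + Site.supNorm c := by
      have h := Site.supNorm_add_le (c + xx) (-c)
      rwa [Site.supNorm_neg, add_neg_cancel_comm] at h
    have h2 := Site.supNorm_add_le c xx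
    constructor <;> omega
  have h0 : ∀ (mm : ℕ) (xx : Site d), 1 ≤ mm → 2 * mm ≤ Site.supNorm xx → (0 : Site d) ∉ (box d mm).image (· + xx) := by
    intro mm xx hmm h2 h0
    have h1 := (hWnorm mm xx 0 h0).1
    have h3 : Site.supNorm (0 : Site d) = 0 := Site.supNorm_eq_zero_iff.2 rfl
    omega
  have hW₁ : ∀ u ∈ (box d m₁).image (· + x₁), u ∈ box d ρ := fun u hu =>
    mem_box_iff_supNorm_le.2 (hWnorm m₁ x₁ u hu).2
  have hW₂ : ∀ u ∈ (box d m₂).image (· + x₂), u ∉ box d ρ' := fun u hu h' => by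
    have h1 := (hWnorm m₂ x₂ u hu).1
    have h2 := mem_box_iff_supNorm_le.1 h'
    omega
  have hρρ' : ρ + 1 ≤ ρ' := by omega
  -- the events
  set H₁ : Set (BondConfig (Site d)) := {ω : BondConfig (Site d) | ∃ w ∈ (box d m₁).image (· + x₁),
    ω ∈ openConnIn (↑(box d N) : Set (Site d)) (0 : Site d) w} with hH₁
  set H₂ : Set (BondConfig (Site d)) := {ω : BondConfig (Site d) | ∃ w ∈ (box d m₂).image (· + x₂),
    ω ∈ openConnIn (↑(box d N) : Set (Site d)) (0 : Site d) w} with hH₂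
  set T₁ : Set (BondConfig (Site d)) := {ω : BondConfig (Site d) | ∃ q ∈ (box d m₁).image (· + x₁),
    ∃ s' ∈ (innerBoundary (zdGraph d) (box d n₁)).image (· + x₁), ω ∈ openConnIn (↑((box d n₁).image (· + x₁)) : Set (Site d)) q s'}
    with hT₁
  set T₂ : Set (BondConfig (Site d)) := {ω : BondConfig (Site d) | ∃ q ∈ (box d m₂).image (· + x₂),
    ∃ s' ∈ (innerBoundary (zdGraph d) (box d n₂)).image (· + x₂), ω ∈ openConnIn (↑((box d n₂).image (· + x₂)) : Set (Site d)) q s'}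
    with hT₂
  set U₁ : Set (BondConfig (Site d)) := {ω : BondConfig (Site d) | ∃ s' ∈ innerBoundary (zdGraph d) (box d (2 * n₁ + 1 + 1)),
    ∃ t ∈ innerBoundary (zdGraph d) (box d N), ω ∈ openConnIn ((↑(box d N) : Set (Site d)) \ ↑(box d (2 * n₁ + 1))) s' t} with hU₁
  set U₂ : Set (BondConfig (Site d)) := {ω : BondConfig (Site d) | ∃ s' ∈ innerBoundary (zdGraph d) (box d (2 * n₂ + 1 + 1)),
    ∃ t ∈ innerBoundary (zdGraph d) (box d N), ω ∈ openConnIn ((↑(box d N) : Set (Site d)) \ ↑(box d (2 * n₂ + 1))) s' t} with hU₂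
  set X : Set (BondConfig (Site d)) := {ω : BondConfig (Site d) | ∃ s' ∈ innerBoundary (zdGraph d) (box d (ρ + 1)),
    ∃ t ∈ innerBoundary (zdGraph d) (box d ρ'), ω ∈ openConnIn ((↑(box d ρ') : Set (Site d)) \ ↑(box d ρ)) s' t} with hX
  set G₁ : Set (BondConfig (Site d)) := (H₁ ∪ H₂) □ (T₁ □ U₁) with hG₁
  set G₂ : Set (BondConfig (Site d)) := H₂ □ (T₂ □ U₂) with hG₂
  set G₃ : Set (BondConfig (Site d)) := H₁ □ (X □ (T₂ □ U₂)) with hG₃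
  set G : Set (BondConfig (Site d)) := G₁ ∪ G₂ ∪ G₃ with hG
  -- upper sets, finitary
  have hHup : ∀ (mm : ℕ) (xx : Site d), IsUpperSet {ω : BondConfig (Site d) | ∃ w ∈ (box d mm).image (· + xx),
      ω ∈ openConnIn (↑(box d N) : Set (Site d)) (0 : Site d) w} :=
    fun mm xx ω ω' hle ⟨w, hw, h1⟩ => ⟨w, hw, isUpperSet_openConnIn _ _ _ hle h1⟩
  have hHf : ∀ (mm : ℕ) (xx : Site d), IsFinitary {ω : BondConfig (Site d) | ∃ w ∈ (box d mm).image (· + xx),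
      ω ∈ openConnIn (↑(box d N) : Set (Site d)) (0 : Site d) w} := by
    rintro mm xx ω ⟨w, hw, h'⟩
    obtain ⟨K, hKω, hK⟩ := isFinitary_openConnIn (↑(box d N) : Set (Site d)) (0 : Site d) w ω h'
    exact ⟨K, hKω, w, hw, hK⟩
  have hTup : ∀ (mm nn : ℕ) (xx : Site d), IsUpperSet {ω : BondConfig (Site d) | ∃ q ∈ (box d mm).image (· + xx),
      ∃ s' ∈ (innerBoundary (zdGraph d) (box d nn)).image (· + xx), ω ∈ openConnIn (↑((box d nn).image (· + xx)) : Set (Site d)) q s'} :=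
    fun mm nn xx ω ω' hle ⟨q', hq', s', hs', h1⟩ => ⟨q', hq', s', hs', isUpperSet_openConnIn _ _ _ hle h1⟩
  have hTf : ∀ (mm nn : ℕ) (xx : Site d), IsFinitary {ω : BondConfig (Site d) | ∃ q ∈ (box d mm).image (· + xx),
      ∃ s' ∈ (innerBoundary (zdGraph d) (box d nn)).image (· + xx), ω ∈ openConnIn (↑((box d nn).image (· + xx)) : Set (Site d)) q s'} := by
    rintro mm nn xx ω ⟨q', hq', s', hs', h'⟩
    obtain ⟨K, hKω, hK⟩ := isFinitary_openConnIn _ q' s' ω h'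
    exact ⟨K, hKω, q', hq', s', hs', hK⟩
  have hH₁up : IsUpperSet H₁ := hHup m₁ x₁
  have hH₂up : IsUpperSet H₂ := hHup m₂ x₂
  have hH₁₂up : IsUpperSet (H₁ ∪ H₂) := hH₁up.union hH₂up
  have hH₁f : IsFinitary H₁ := hHf m₁ x₁
  have hH₂f : IsFinitary H₂ := hHf m₂ x₂
  have hH₁₂f : IsFinitary (H₁ ∪ H₂) := by
    rintro ω (hω | hω)
    · obtain ⟨K, hK, hK'⟩ := hH₁f ω hω; exact ⟨K, hK, Or.inl hK'⟩
    · obtain ⟨K, hK, hK'⟩ := hH₂f ω hω; exact ⟨K, hK, Or.inr hK'⟩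
  have hT₁up : IsUpperSet T₁ := hTup m₁ n₁ x₁
  have hT₂up : IsUpperSet T₂ := hTup m₂ n₂ x₂
  have hT₁f : IsFinitary T₁ := hTf m₁ n₁ x₁
  have hT₂f : IsFinitary T₂ := hTf m₂ n₂ x₂
  have hU₁up : IsUpperSet U₁ := isUpperSet_tail (2 * n₁ + 1) N
  have hU₂up : IsUpperSet U₂ := isUpperSet_tail (2 * n₂ + 1) N
  have hU₁f : IsFinitary U₁ := isFinitary_tail (2 * n₁ + 1) N
  have hU₂f : IsFinitary U₂ := isFinitary_tail (2 * n₂ + 1) N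
  have hXup : IsUpperSet X := isUpperSet_tail ρ ρ'
  have hXf : IsFinitary X := isFinitary_tail ρ ρ'
  have hTU₁up : IsUpperSet (T₁ □ U₁) := hT₁up.disjointOccurrence hU₁up
  have hTU₂up : IsUpperSet (T₂ □ U₂) := hT₂up.disjointOccurrence hU₂up
  have hTU₁f : IsFinitary (T₁ □ U₁) := IsFinitary.disjointOccurrence hT₁up hU₁up hT₁f hU₁f
  have hTU₂f : IsFinitary (T₂ □ U₂) := IsFinitary.disjointOccurrence hT₂up hU₂up hT₂f hU₂f
  have hXTUup : IsUpperSet (X □ (T₂ □ U₂)) := hXup.disjointOccurrence hTU₂up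
  have hXTUf : IsFinitary (X □ (T₂ □ U₂)) := IsFinitary.disjointOccurrence hXup hTU₂up hXf hTU₂f
  have hG₁up : IsUpperSet G₁ := hH₁₂up.disjointOccurrence hTU₁up
  have hG₂up : IsUpperSet G₂ := hH₂up.disjointOccurrence hTU₂up
  have hG₃up : IsUpperSet G₃ := hH₁up.disjointOccurrence hXTUup
  have hG₁m : MeasurableSet G₁ := IsFinitary.measurableSet hG₁up (IsFinitary.disjointOccurrence hH₁₂up hTU₁up hH₁₂f hTU₁f)
  have hG₂m : MeasurableSet G₂ := IsFinitary.measurableSet hG₂up (IsFinitary.disjointOccurrence hH₂up hTU₂up hH₂f hTU₂f)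
  have hG₃m : MeasurableSet G₃ := IsFinitary.measurableSet hG₃up (IsFinitary.disjointOccurrence hH₁up hXTUup hH₁f hXTUf)
  have hGm : MeasurableSet G := (hG₁m.union hG₂m).union hG₃m
  have hGup : IsUpperSet G := (hG₁up.union hG₂up).union hG₃up
  -- the alternative
  have hAG : ∀ ω : BondConfig (Site d), ω ⊆ (zdGraph d).edgeSet → ω ∈ siteToBoundary d N →
      ω \ (↑F : Set (Sym2 (Site d))) ∈ siteToBoundary d N ∨ ω \ (↑F : Set (Sym2 (Site d))) ∈ G := by
    intro ω hω h
    rcases siteToBoundary_sdiff_or_mem_threeAlternatives_twoShells F hF (h0 m₁ x₁ hm₁ h2m₁) (h0 m₂ x₂ hm₂ h2m₂) (by omega) (by omega)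
        hW₁ hW₂ hρρ' (by omega) (by omega) hω h with h' | h' | h' | h'
    · exact Or.inl h'
    · exact Or.inr (Or.inl (Or.inl h'))
    · exact Or.inr (Or.inl (Or.inr h'))
    · exact Or.inr (Or.inr h')
  have hdec := abs_real_inter_siteToBoundary_sub_mul_le_of_sdiff (criticalProbI d) F hGm hAG hE
  have hfG : μ.real {ω : BondConfig (Site d) | ω \ (↑F : Set (Sym2 (Site d))) ∈ G} ≤ μ.real G :=
    measureReal_mono (fun ω hω => hGup (Set.sdiff_subset (s := ω) (t := ↑F)) hω) (measure_ne_top _ _)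
  -- the pieces' probabilities
  have hHle : ∀ (mm : ℕ) (xx : Site d), 1 ≤ mm → 2 * mm ≤ Site.supNorm xx →
      μ.real {ω : BondConfig (Site d) | ∃ w ∈ (box d mm).image (· + xx), ω ∈ openConnIn (↑(box d N) : Set (Site d)) (0 : Site d) w} ≤
        B * oneArmProb d (criticalProbI d) (Site.supNorm xx) := by
    intro mm xx hmm h2
    have h1 : μ.real {ω : BondConfig (Site d) | ∃ w ∈ (box d mm).image (· + xx), ω ∈ openConnIn (↑(box d N) : Set (Site d)) (0 : Site d) w} ≤
        oneArmProb d (criticalProbI d) (Site.supNorm xx - mm) := by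
      refine real_mono_of_forall_subset_edgeSet (zdGraph d) _ fun ω hω ⟨w, hw, h0w⟩ => ?_
      have hcx := (hWnorm mm xx w hw).1
      refine siteToBoundary_of_openConnIn_of_notMem (by omega) hω (fun h' => ?_) h0w
      have := mem_box_iff_supNorm_le.1 h'; omega
    exact h1.trans (hR _ _ (by omega) (by omega) (by omega))
  have hTle : ∀ (mm : ℕ) (xx : Site d), 1 ≤ mm → mm ≤ Site.supNorm xx →
      μ.real {ω : BondConfig (Site d) | ∃ q ∈ (box d mm).image (· + xx),
        ∃ s' ∈ (innerBoundary (zdGraph d) (box d (Site.supNorm xx))).image (· + xx),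
        ω ∈ openConnIn (↑((box d (Site.supNorm xx)).image (· + xx)) : Set (Site d)) q s'} ≤
        oneArmProb d (criticalProbI d) (Site.supNorm xx) / (cq * oneArmProb d (criticalProbI d) mm) := by
    intro mm xx hmm hmn
    rw [real_ballCrossing_eq, le_div_iff₀ (mul_pos hcq (hπ mm))]
    have h1 := real_mono_of_forall_subset_edgeSet (zdGraph d) (criticalProbI d) fun ω hω h =>
      link_subset_boxCrossing (R₀ := mm) (R₁ := Site.supNorm xx) hω h
    have h2 := hQM mm (Site.supNorm xx) hmm hmn
    calc μ.real {ω : BondConfig (Site d) | ∃ q ∈ box d mm, ∃ t ∈ innerBoundary (zdGraph d) (box d (Site.supNorm xx)),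
          ω ∈ openConnIn (↑(box d (Site.supNorm xx)) : Set (Site d)) q t} * (cq * oneArmProb d (criticalProbI d) mm)
        = cq * (oneArmProb d (criticalProbI d) mm * μ.real {ω : BondConfig (Site d) | ∃ q ∈ box d mm,
          ∃ t ∈ innerBoundary (zdGraph d) (box d (Site.supNorm xx)), ω ∈ openConnIn (↑(box d (Site.supNorm xx)) : Set (Site d)) q t}) := by
          ring
      _ ≤ cq * (oneArmProb d (criticalProbI d) mm * μ.real (boxCrossing d mm (Site.supNorm xx))) :=
          mul_le_mul_of_nonneg_left (mul_le_mul_of_nonneg_left h1 (hπ mm).le) hcq.le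
      _ ≤ oneArmProb d (criticalProbI d) (Site.supNorm xx) := h2
  -- a crossing `∂ⁱⁿΛ(a+1) ↔ ∂ⁱⁿΛ(b)` off `Λ(a)` costs `π(b)/(c π(a+1))`
  have hcross : ∀ a b : ℕ, a + 1 ≤ b →
      μ.real {ω : BondConfig (Site d) | ∃ s' ∈ innerBoundary (zdGraph d) (box d (a + 1)),
        ∃ t ∈ innerBoundary (zdGraph d) (box d b), ω ∈ openConnIn ((↑(box d b) : Set (Site d)) \ ↑(box d a)) s' t} ≤
        oneArmProb d (criticalProbI d) b / (cq * oneArmProb d (criticalProbI d) (a + 1)) := by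
    intro a b hab
    have hT : μ.real {ω : BondConfig (Site d) | ∃ s' ∈ innerBoundary (zdGraph d) (box d (a + 1)),
        ∃ t ∈ innerBoundary (zdGraph d) (box d b), ω ∈ openConnIn ((↑(box d b) : Set (Site d)) \ ↑(box d a)) s' t} ≤
        μ.real (boxCrossing d (a + 1) b) := by
      rw [← real_cross_eq_real_boxCrossing (criticalProbI d) hab]
      refine measureReal_mono (fun ω hω => ?_) (measure_ne_top _ _)
      obtain ⟨u, hu, t, ht, hut⟩ := hω
      exact ⟨u, (mem_innerBoundary_iff.1 hu).1, t, ht, openConnIn_mono (fun x hx => hx.1) _ _ hut⟩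
    have hqm := hQM (a + 1) b (by omega) hab
    rw [le_div_iff₀ (mul_pos hcq (hπ _))]
    calc μ.real {ω : BondConfig (Site d) | ∃ s' ∈ innerBoundary (zdGraph d) (box d (a + 1)),
          ∃ t ∈ innerBoundary (zdGraph d) (box d b), ω ∈ openConnIn ((↑(box d b) : Set (Site d)) \ ↑(box d a)) s' t} *
          (cq * oneArmProb d (criticalProbI d) (a + 1))
        ≤ μ.real (boxCrossing d (a + 1) b) * (cq * oneArmProb d (criticalProbI d) (a + 1)) :=
          mul_le_mul_of_nonneg_right hT (mul_nonneg hcq.le (hπ _).le)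
      _ = cq * (oneArmProb d (criticalProbI d) (a + 1) * μ.real (boxCrossing d (a + 1) b)) := by ring
      _ ≤ oneArmProb d (criticalProbI d) b := hqm
  -- numerical facts
  set π₁ := oneArmProb d (criticalProbI d) n₁ with hπ₁
  set π₂ := oneArmProb d (criticalProbI d) n₂ with hπ₂
  set πm₁ := oneArmProb d (criticalProbI d) m₁ with hπm₁
  set πm₂ := oneArmProb d (criticalProbI d) m₂ with hπm₂
  have hπ₁0 : 0 < π₁ := hπ _
  have hπ₂0 : 0 < π₂ := hπ _
  have hπm₁0 : 0 < πm₁ := hπ _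
  have hπm₂0 : 0 < πm₂ := hπ _
  have hπN0 : 0 < oneArmProb d (criticalProbI d) N := hπ _
  have hπ21 : π₂ ≤ π₁ := real_siteToBoundary_antitone (criticalProbI d) (by omega : n₁ ≤ n₂)
  have hH₁le : μ.real H₁ ≤ B * π₁ := hHle m₁ x₁ hm₁ h2m₁
  have hH₂le : μ.real H₂ ≤ B * π₂ := hHle m₂ x₂ hm₂ h2m₂
  have hT₁le : μ.real T₁ ≤ π₁ / (cq * πm₁) := hTle m₁ x₁ hm₁ (by omega)
  have hT₂le : μ.real T₂ ≤ π₂ / (cq * πm₂) := hTle m₂ x₂ hm₂ (by omega)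
  have hU₁le : μ.real U₁ ≤ B * oneArmProb d (criticalProbI d) N / (cq * π₁) := by
    have h1 := hcross (2 * n₁ + 1) N (by omega)
    have h2 : π₁ ≤ B * oneArmProb d (criticalProbI d) (2 * n₁ + 1 + 1) := hR n₁ _ (by omega) (by omega) (by omega)
    refine h1.trans ?_
    rw [div_le_div_iff₀ (mul_pos hcq (hπ _)) (mul_pos hcq hπ₁0)]
    calc oneArmProb d (criticalProbI d) N * (cq * π₁)
          ≤ oneArmProb d (criticalProbI d) N * (cq * (B * oneArmProb d (criticalProbI d) (2 * n₁ + 1 + 1))) :=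
          mul_le_mul_of_nonneg_left (mul_le_mul_of_nonneg_left h2 hcq.le) hπN0.le
      _ = B * oneArmProb d (criticalProbI d) N * (cq * oneArmProb d (criticalProbI d) (2 * n₁ + 1 + 1)) := by ring
  have hU₂le : μ.real U₂ ≤ B * oneArmProb d (criticalProbI d) N / (cq * π₂) := by
    have h1 := hcross (2 * n₂ + 1) N (by omega)
    have h2 : π₂ ≤ B * oneArmProb d (criticalProbI d) (2 * n₂ + 1 + 1) := hR n₂ _ (by omega) (by omega) (by omega)
    refine h1.trans ?_
    rw [div_le_div_iff₀ (mul_pos hcq (hπ _)) (mul_pos hcq hπ₂0)]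
    calc oneArmProb d (criticalProbI d) N * (cq * π₂)
          ≤ oneArmProb d (criticalProbI d) N * (cq * (B * oneArmProb d (criticalProbI d) (2 * n₂ + 1 + 1))) :=
          mul_le_mul_of_nonneg_left (mul_le_mul_of_nonneg_left h2 hcq.le) hπN0.le
      _ = B * oneArmProb d (criticalProbI d) N * (cq * oneArmProb d (criticalProbI d) (2 * n₂ + 1 + 1)) := by ring
  have hXle : μ.real X ≤ B ^ 2 * π₂ / (cq * π₁) := by
    have h1 := hcross ρ ρ' hρρ'
    have h2 : oneArmProb d (criticalProbI d) ρ' ≤ B * π₂ := hR ρ' n₂ (by omega) (by omega) (by omega)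
    have h3 : π₁ ≤ B * oneArmProb d (criticalProbI d) (ρ + 1) := hR n₁ (ρ + 1) (by omega) (by omega) (by omega)
    refine h1.trans ?_
    rw [div_le_div_iff₀ (mul_pos hcq (hπ _)) (mul_pos hcq hπ₁0)]
    calc oneArmProb d (criticalProbI d) ρ' * (cq * π₁) ≤ (B * π₂) * (cq * (B * oneArmProb d (criticalProbI d) (ρ + 1))) :=
          mul_le_mul h2 (mul_le_mul_of_nonneg_left h3 hcq.le) (mul_nonneg hcq.le hπ₁0.le) (mul_nonneg hB.le hπ₂0.le)
      _ = B ^ 2 * π₂ * (cq * oneArmProb d (criticalProbI d) (ρ + 1)) := by ring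
  -- the three alternatives (values of the `π`'s cleared: arithmetic on opaque reals)
  set πN := oneArmProb d (criticalProbI d) N with hπN
  clear_value η₁ η₂ πN π₁ π₂ πm₁ πm₂
  have hG₁le : μ.real G₁ ≤ 2 * B ^ 2 / cq ^ 2 * η₁ * πN := by
    have hbk : μ.real G₁ ≤ μ.real (H₁ ∪ H₂) * (μ.real T₁ * μ.real U₁) :=
      (bk_finitary (zdGraph d) _ hH₁₂up hTU₁up hH₁₂f hTU₁f).trans
        (mul_le_mul_of_nonneg_left (bk_finitary (zdGraph d) _ hT₁up hU₁up hT₁f hU₁f) measureReal_nonneg)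
    have hH : μ.real (H₁ ∪ H₂) ≤ 2 * B * π₁ :=
      calc μ.real (H₁ ∪ H₂) ≤ μ.real H₁ + μ.real H₂ := measureReal_union_le _ _
        _ ≤ B * π₁ + B * π₂ := add_le_add hH₁le hH₂le
        _ ≤ B * π₁ + B * π₁ := by have := mul_le_mul_of_nonneg_left hπ21 hB.le; linarith
        _ = 2 * B * π₁ := by ring
    have hprod : μ.real (H₁ ∪ H₂) * (μ.real T₁ * μ.real U₁) ≤ (2 * B * π₁) * ((π₁ / (cq * πm₁)) * (B * πN / (cq * π₁))) :=
      mul_le_mul hH (mul_le_mul hT₁le hU₁le measureReal_nonneg (div_nonneg hπ₁0.le (mul_nonneg hcq.le hπm₁0.le)))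
        (mul_nonneg measureReal_nonneg measureReal_nonneg) (mul_nonneg (mul_nonneg (by norm_num) hB.le) hπ₁0.le)
    have heq : (2 * B * π₁) * ((π₁ / (cq * πm₁)) * (B * πN / (cq * π₁))) = 2 * B ^ 2 / cq ^ 2 * η₁ * πN := by
      have := hπ₁0.ne'; have := hπm₁0.ne'; have := hcq.ne'
      rw [hη₁]; field_simp
    exact hbk.trans (hprod.trans heq.le)
  have hG₂le : μ.real G₂ ≤ B ^ 2 / cq ^ 2 * η₂ * πN := by
    have hbk : μ.real G₂ ≤ μ.real H₂ * (μ.real T₂ * μ.real U₂) :=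
      (bk_finitary (zdGraph d) _ hH₂up hTU₂up hH₂f hTU₂f).trans
        (mul_le_mul_of_nonneg_left (bk_finitary (zdGraph d) _ hT₂up hU₂up hT₂f hU₂f) measureReal_nonneg)
    have hprod : μ.real H₂ * (μ.real T₂ * μ.real U₂) ≤ (B * π₂) * ((π₂ / (cq * πm₂)) * (B * πN / (cq * π₂))) :=
      mul_le_mul hH₂le (mul_le_mul hT₂le hU₂le measureReal_nonneg (div_nonneg hπ₂0.le (mul_nonneg hcq.le hπm₂0.le)))
        (mul_nonneg measureReal_nonneg measureReal_nonneg) (mul_nonneg hB.le hπ₂0.le)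
    have heq : (B * π₂) * ((π₂ / (cq * πm₂)) * (B * πN / (cq * π₂))) = B ^ 2 / cq ^ 2 * η₂ * πN := by
      have := hπ₂0.ne'; have := hπm₂0.ne'; have := hcq.ne'
      rw [hη₂]; field_simp
    exact hbk.trans (hprod.trans heq.le)
  have hG₃le : μ.real G₃ ≤ B ^ 4 / cq ^ 3 * η₂ * πN := by
    have hbk : μ.real G₃ ≤ μ.real H₁ * (μ.real X * (μ.real T₂ * μ.real U₂)) :=
      (bk_finitary (zdGraph d) _ hH₁up hXTUup hH₁f hXTUf).trans
        (mul_le_mul_of_nonneg_left ((bk_finitary (zdGraph d) _ hXup hTU₂up hXf hTU₂f).trans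
          (mul_le_mul_of_nonneg_left (bk_finitary (zdGraph d) _ hT₂up hU₂up hT₂f hU₂f) measureReal_nonneg)) measureReal_nonneg)
    have hprod : μ.real H₁ * (μ.real X * (μ.real T₂ * μ.real U₂)) ≤
        (B * π₁) * ((B ^ 2 * π₂ / (cq * π₁)) * ((π₂ / (cq * πm₂)) * (B * πN / (cq * π₂)))) :=
      mul_le_mul hH₁le (mul_le_mul hXle (mul_le_mul hT₂le hU₂le measureReal_nonneg
        (div_nonneg hπ₂0.le (mul_nonneg hcq.le hπm₂0.le))) (mul_nonneg measureReal_nonneg measureReal_nonneg)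
        (div_nonneg (mul_nonneg (pow_nonneg hB.le 2) hπ₂0.le) (mul_nonneg hcq.le hπ₁0.le)))
        (mul_nonneg measureReal_nonneg (mul_nonneg measureReal_nonneg measureReal_nonneg)) (mul_nonneg hB.le hπ₁0.le)
    have heq : (B * π₁) * ((B ^ 2 * π₂ / (cq * π₁)) * ((π₂ / (cq * πm₂)) * (B * πN / (cq * π₂)))) = B ^ 4 / cq ^ 3 * η₂ * πN := by
      have := hπ₁0.ne'; have := hπ₂0.ne'; have := hπm₂0.ne'; have := hcq.ne'
      rw [hη₂]; field_simp
    exact hbk.trans (hprod.trans heq.le)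
  have hGle : μ.real G ≤ (2 * B ^ 2 / cq ^ 2 + B ^ 2 / cq ^ 2 + B ^ 4 / cq ^ 3) * (η₁ + η₂) * πN := by
    have h1 : μ.real G ≤ μ.real G₁ + μ.real G₂ + μ.real G₃ :=
      (measureReal_union_le _ _).trans (add_le_add (measureReal_union_le _ _) le_rfl)
    have hc1 : 0 ≤ 2 * B ^ 2 / cq ^ 2 := by positivity
    have hc2 : 0 ≤ B ^ 2 / cq ^ 2 := by positivity
    have hc3 : 0 ≤ B ^ 4 / cq ^ 3 := by positivity
    have h2 : 2 * B ^ 2 / cq ^ 2 * η₁ * πN ≤ 2 * B ^ 2 / cq ^ 2 * (η₁ + η₂) * πN :=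
      mul_le_mul_of_nonneg_right (mul_le_mul_of_nonneg_left (le_add_of_nonneg_right hη₂0) hc1) hπN0.le
    have h3 : B ^ 2 / cq ^ 2 * η₂ * πN ≤ B ^ 2 / cq ^ 2 * (η₁ + η₂) * πN :=
      mul_le_mul_of_nonneg_right (mul_le_mul_of_nonneg_left (le_add_of_nonneg_left hη₁0) hc2) hπN0.le
    have h4 : B ^ 4 / cq ^ 3 * η₂ * πN ≤ B ^ 4 / cq ^ 3 * (η₁ + η₂) * πN :=
      mul_le_mul_of_nonneg_right (mul_le_mul_of_nonneg_left (le_add_of_nonneg_left hη₁0) hc3) hπN0.le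
    have h5 : 2 * B ^ 2 / cq ^ 2 * (η₁ + η₂) * πN + B ^ 2 / cq ^ 2 * (η₁ + η₂) * πN + B ^ 4 / cq ^ 3 * (η₁ + η₂) * πN =
        (2 * B ^ 2 / cq ^ 2 + B ^ 2 / cq ^ 2 + B ^ 4 / cq ^ 3) * (η₁ + η₂) * πN := by ring
    linarith [hG₁le, hG₂le, hG₃le, h1, h2, h3, h4, h5]
  -- assemble
  calc |μ.real (E ∩ siteToBoundary d N) - μ.real E * πN|
      ≤ μ.real E * μ.real {ω : BondConfig (Site d) | ω \ (↑F : Set (Sym2 (Site d))) ∈ G} := hdec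
    _ ≤ μ.real E * ((2 * B ^ 2 / cq ^ 2 + B ^ 2 / cq ^ 2 + B ^ 4 / cq ^ 3) * (η₁ + η₂) * πN) :=
        mul_le_mul_of_nonneg_left (hfG.trans hGle) measureReal_nonneg
    _ = (2 * B ^ 2 / cq ^ 2 + B ^ 2 / cq ^ 2 + B ^ 4 / cq ^ 3) * (η₁ + η₂) * μ.real E * πN := by ring

end Summit.CriticalPhenomena.PercolationContinuityZ3.Theorems.Crossing

end
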